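import Summits.BirchSwinnertonDyer.BirchSwinnertonDyer.Theorems.SignedLowerHalvesKobayashiLowerHalfLargeImageCongruenceShapeBound
import HarnessLib

/-!
# Route `SignedLowerHalves`, crux `KobayashiLowerHalfLargeImage` (item stmt-BirchSwinnertonDyer-19001):
# the HIGHER-RANK SQUEEZE — Kobayashi's main conjecture at a pair whose certified `λ(L^ε_p(E))` does not
# exceed `rank E(ℚ)`, with NO partner (cell `bsd-ssimc`, seat `bsd-ssimc-k3-c3` gen 8, object «CONG-λ-BOUND»,
# the degenerate case `E′ = E` of the lower-bound road; `--supports stmt-BirchSwinnertonDyer-19001 --as helper`;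
# closes nothing)

PARTITION (cell bsd-ssimc): X7 (A7) × item 3's large-image pairs — types-the-object-of (the rank-`r` twin of the
rank-one squeeze `Supersingular.kobayashiMainConjecture_of_lam_eq_one_of_analyticRank_eq_one` /
`…_of_cert_at_conductor_of_analyticRank_eq_one`, p214698: there `λ = 1 = r_an` via GZK; here `λ ≤ rank E(ℚ)` for
ANY rank, the rank entering as a datum `hr`); closes PER PAIR only where such a certificate exists (for the
rank-one window this is exactly the tight case already covered; the statement is recorded for the donors
themselves — e.g. a rank-two curve with `λ(L^ε_3) = 2` — and for any future higher-rank use); crux OPEN; nothing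
booked; BSD is not proved by any of this. THEOREMS ONLY.

ROAD: Kato `ξ ∣ L` (Kobayashi Thm. 4.1, integral under surjectivity) gives `μ(ξ) ≤ μ(L) = 0`-side and
`λ(ξ) ≤ λ(L) = l`; the tree theorem `T^{rank E(ℚ)} ∣ ξ` (`X_pow_mordellWeilRank_dvd_of_charIdeal_eq_span`) and
`hr : l ≤ rank E(ℚ)` give `λ(ξ) ≥ l`; the squeeze `span_eq_span_iff_mu_le_and_lam_le` gives `(ξ) = (L)`;
`ϖ ∈ ℤ_p^×` by `h5`/`h3`. No B. D. Kim, no partner, no GZK.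

References: [Kobayashi2003] Conj. (p. 2), Thm. 1.2, Thm. 4.1 (p. 8); [GreenbergLNM1716] §3 Lemma 3.1;
[GreenbergVatsal2000] p. 4, §3 Remark 3.4; [Pollack2003] Def. 6.15, Prop. 6.9/6.10/6.18; [Wuthrich2014] Lemma 20.
-/

set_option autoImplicit false
set_option linter.dupNamespace false
noncomputable section

open scoped Classical MatrixGroups ModularForm BigOperators

open CongruenceSubgroup WeierstrassCurve NumberField IsDedekindDomain
  Literature.NumberTheory.EllipticCurves
  Literature.NumberTheory.EllipticCurves.ModularForms
  Literature.NumberTheory.EllipticCurves.Rank1Residual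
  Literature.NumberTheory.EllipticCurves.Rank1Residual.Typed
  Literature.NumberTheory.EllipticCurves.Kobayashi2003 ZpExtension
  Literature.NumberTheory.EllipticCurves.GreenbergVatsal2000
  Summit.BirchSwinnertonDyer.Rank1Residual.X1.MuLambda
  Summit.BirchSwinnertonDyer.Rank1Residual.Supersingular

namespace Summit.BirchSwinnertonDyer.BirchSwinnertonDyer.Theorems.CongruenceRoad

variable {W : WeierstrassCurve ℚ} [W.IsElliptic] [W.IsGloballyMinimal] {p : ℕ} [Fact p.Prime]

/-- **The higher-rank squeeze, certificate at the conductor.** `p` odd good, `a_p = 0`, `ρ̄_{E,p}` onto, the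
newform `f₀` of `E = W` with the two-engine certificate `hcert₀ : (μ, λ)(L^ε_p(E)) = (0, l)`, and the rank
datum `hr : l ≤ rank E(ℚ)`: then `KobayashiMainConjecture W p ε` — `λ(ξ) ≤ l` by Kato's `ξ ∣ L` and `λ(ξ) ≥
rank E(ℚ) ≥ l` by `T^{rank} ∣ ξ`. Inputs BY NAME: `h12`, `h41`, `h5`/`h3`, `hL20`. PER PAIR; NOT a class
theorem; the case `l = 1 = r_an` is the tree's rank-one squeeze. [cite: Kobayashi2003, Thm. 1.2, Thm. 4.1 (p. 8) and Conjecture (p. 2)]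
[cite: GreenbergLNM1716, §3 Lemma 3.1] [cite: GreenbergVatsal2000, p. 4 and §3 Remark 3.4] [cite: Wuthrich2014, Lemma 20 (p. 399)] -/
theorem kobayashiMainConjecture_of_cert_of_le_mordellWeilRank_at_conductor
    (h12 : Kobayashi2003.thm12_signedSelmerDual_finite_torsion)
    (h41 : Kobayashi2003.thm41_signedCharIdeal_divisibility)
    (h5 : realPeriodRat_eq_unit_mul_plusPeriod) (h3 : realPeriodRat_eq_unit_mul_plusPeriod_three)
    (hL20 : Wuthrich2014.lemma20_surjective_threeAdic_of_semistable)
    (hp : p ≠ 2) (hgood : W.HasGoodReductionAtPrime p) (hap : W.frobeniusTrace p = 0)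
    (hs : Surj W p) (ε : ℤˣ) {l : ℕ}
    [NeZero (W.conductorNorm ℤ)] {f₀ : CuspForm (Gamma0 (W.conductorNorm ℤ)) 2} (hf₀ : IsNewformOf W f₀)
    (hcert₀ : ∀ L : IwasawaAlgebra p, IsSignedPAdicLFunction f₀ p ε L → mu L = 0 ∧ lam L = l)
    (hr : l ≤ W.mordellWeilRank) :
    KobayashiMainConjecture W p ε := by
  intro κ γ hκ hγ hγ' _ f hf ϖ hϖ Lplus Lminus hPP D
  have hff : f = f₀ := hf.unique hf₀
  subst hff
  haveI : Module.Finite (IwasawaAlgebra p) D.X := h12.moduleFinite hp hgood hap hκ hγ D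
  have hX : Module.IsTorsion (IwasawaAlgebra p) D.X := h12.isTorsion hp hgood hap hκ hγ D
  refine ⟨hX, ?_⟩
  obtain ⟨ξ, hξ⟩ := (charIdeal_isPrincipal_holds p D.X).principal
  have hξ' : D.charIdeal = Ideal.span {ξ} := hξ
  set L := kobayashiL ε Lplus Lminus with hL_def
  have hL : IsSignedPAdicLFunction f p ε L := hPP.isSignedPAdicLFunction_kobayashiL ε
  -- Kato–Kobayashi: `ξ ∣ L`
  have hsurj : ∀ m : ℕ, W.HasSurjectiveModNGaloisRep (p ^ m : ℕ) :=
    surjective_pow_of_surj_of_good W p hL20 hp hgood hs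
  have hU : ξ ∣ L := h41.dvd_of_charIdeal_eq_span hp hgood hap hf hκ hγ hγ' hL D hX hsurj hξ'
  obtain ⟨hμL, hlamL⟩ := hcert₀ L hL
  have hL0 : L ≠ 0 := by
    rw [hL_def]
    unfold kobayashiL
    split_ifs
    · exact hPP.2.1
    · exact hPP.1
  obtain ⟨h, hfac⟩ := hU
  have hξ0 : ξ ≠ 0 := by
    rintro rfl
    exact hL0 (by rw [hfac, zero_mul])
  -- (C): `T^{rank E(ℚ)} ∣ ξ`, so `λ(ξ) ≥ rank E(ℚ) ≥ l`
  have hC := D.X_pow_mordellWeilRank_dvd_of_charIdeal_eq_span hγ hX hξ'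
  have hlamξ : l ≤ lam ξ :=
    hr.trans (Summit.BirchSwinnertonDyer.Rank1Residual.X2.le_lam_of_X_pow_dvd hξ0 hC)
  -- the squeeze `(ξ) = (L)`
  have hspan : Ideal.span ({ξ} : Set (IwasawaAlgebra p)) = Ideal.span {L} :=
    ((span_eq_span_iff_mu_le_and_lam_le hξ0 hL0 hfac).mpr
      ⟨by rw [hμL]; exact Nat.zero_le _, by rw [hlamL]; exact hlamξ⟩).symm
  -- the period ratio `ϖ` is a `p`-adic unit
  have hirr : W.HasIrreducibleModPGaloisRep p :=
    hasIrreducibleModPGaloisRep_of_dvd_frobeniusTrace W p hp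
      (W.not_dvd_minimalDiscriminantInt_of_hasGoodReductionAtPrime' p hgood) (by rw [hap]; exact dvd_zero _)
  have hvϖ : padicValRat p ϖ = 0 := padicValRat_periodRatio_eq_zero h5 h3 W p hp hgood hirr f hf ϖ hϖ
  have hϖ0 : ϖ ≠ 0 := by
    intro h0
    rw [h0, Rat.cast_zero, zero_mul] at hϖ
    exact (IsNewform0.plusPeriod_pos_holds hf.1 hf.coeffField_eq_bot).ne' hϖ.symm
  obtain ⟨u, hu⟩ := exists_units_coe_eq_ratCast hϖ0 hvϖ
  obtain ⟨hspan', hι⟩ := span_C_units_mul_eq u L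
  refine ⟨PowerSeries.C (u : ℤ_[p]) * L, ?_, ?_⟩
  · rw [hξ', hspan, hspan']
  · rw [hι, hu]

/-- **Higher-rank squeeze from an ODD-layer Mazur–Tate row** (`ε = −1`): `n` odd, `λ(Θ) = deg ω_n^+ + l`,
`hr : l ≤ rank E(ℚ)`. PER PAIR. [cite: Pollack2003, Def. 6.15, Prop. 6.9, 6.10 and 6.18]
[cite: Kobayashi2003, Thm. 4.1 (p. 8) and Conjecture (p. 2)] [cite: GreenbergLNM1716, §3 Lemma 3.1] -/
theorem kobayashiMainConjecture_neg_one_of_mazurTate_of_le_mordellWeilRank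
    (h12 : Kobayashi2003.thm12_signedSelmerDual_finite_torsion)
    (h41 : Kobayashi2003.thm41_signedCharIdeal_divisibility)
    (h5 : realPeriodRat_eq_unit_mul_plusPeriod) (h3 : realPeriodRat_eq_unit_mul_plusPeriod_three)
    (hL20 : Wuthrich2014.lemma20_surjective_threeAdic_of_semistable)
    (hp : p ≠ 2) (hgood : W.HasGoodReductionAtPrime p) (hap : W.frobeniusTrace p = 0)
    (hs : Surj W p) {l : ℕ}
    [NeZero (W.conductorNorm ℤ)] {f₀ : CuspForm (Gamma0 (W.conductorNorm ℤ)) 2} (hf₀ : IsNewformOf W f₀)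
    {n : ℕ} (hn : Odd n) {Θ : IwasawaAlgebra p}
    (hΘ : iwasawaToPowerSeries p Θ =
      ((mazurTateElement f₀ p n).map (algebraMap ℚ ℚ_[p]) : PowerSeries ℚ_[p]))
    (hΘ0 : Θ ≠ 0) (hμ : mu Θ = 0) (hlam : lam Θ = (cyclotomicOmegaPlus p n).natDegree + l)
    (hr : l ≤ W.mordellWeilRank) :
    KobayashiMainConjecture W p (-1) :=
  kobayashiMainConjecture_of_cert_of_le_mordellWeilRank_at_conductor h12 h41 h5 h3 hL20 hp hgood hap hs (-1) hf₀
    (fun _ hL ↦ lam_signed_neg_one_eq_of_mazurTate' hp hf₀ hgood hap hL hn hΘ hΘ0 hμ hlam) hr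

/-- **Higher-rank squeeze from an EVEN-layer Mazur–Tate row** (`ε = 1`): `n` even, `λ(Θ) = deg ω_n^- + l`,
`hr : l ≤ rank E(ℚ)`. PER PAIR. [cite: Pollack2003, Def. 6.15, Prop. 6.9, 6.10 and 6.18]
[cite: Kobayashi2003, Thm. 4.1 (p. 8) and Conjecture (p. 2)] [cite: GreenbergLNM1716, §3 Lemma 3.1] -/
theorem kobayashiMainConjecture_one_of_mazurTate_of_le_mordellWeilRank
    (h12 : Kobayashi2003.thm12_signedSelmerDual_finite_torsion)
    (h41 : Kobayashi2003.thm41_signedCharIdeal_divisibility)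
    (h5 : realPeriodRat_eq_unit_mul_plusPeriod) (h3 : realPeriodRat_eq_unit_mul_plusPeriod_three)
    (hL20 : Wuthrich2014.lemma20_surjective_threeAdic_of_semistable)
    (hp : p ≠ 2) (hgood : W.HasGoodReductionAtPrime p) (hap : W.frobeniusTrace p = 0)
    (hs : Surj W p) {l : ℕ}
    [NeZero (W.conductorNorm ℤ)] {f₀ : CuspForm (Gamma0 (W.conductorNorm ℤ)) 2} (hf₀ : IsNewformOf W f₀)
    {n : ℕ} (hn : Even n) {Θ : IwasawaAlgebra p}
    (hΘ : iwasawaToPowerSeries p Θ =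
      ((mazurTateElement f₀ p n).map (algebraMap ℚ ℚ_[p]) : PowerSeries ℚ_[p]))
    (hΘ0 : Θ ≠ 0) (hμ : mu Θ = 0) (hlam : lam Θ = (cyclotomicOmegaMinus p n).natDegree + l)
    (hr : l ≤ W.mordellWeilRank) :
    KobayashiMainConjecture W p 1 :=
  kobayashiMainConjecture_of_cert_of_le_mordellWeilRank_at_conductor h12 h41 h5 h3 hL20 hp hgood hap hs 1 hf₀
    (fun _ hL ↦ lam_signed_one_eq_of_mazurTate' hp hf₀ hgood hap hL hn hΘ hΘ0 hμ hlam) hr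

end Summit.BirchSwinnertonDyer.BirchSwinnertonDyer.Theorems.CongruenceRoad

end
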